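import Literature.Computability.AlgebraicComplexity.DepthReduction
import Literature.Computability.AlgebraicComplexity.HomogeneousCircuits
import HarnessLib

/-!
# Named fact: Tavenas' depth reduction, HOMOGENEOUS form (Tavenas 2015, Thm. 1)

Trunk T-CPLX-ALG; cite item `wi-03847` (route ValiantsHypothesis/Depth4, stmt-0332), sibling of
`DepthReduction.lean` (`productDepthCircuitSize_two_le_of_isVPFamily`, the non-homogeneous
weakening) — here with the tree's HOMOGENEOUS product-depth size
`homProductDepthCircuitSize` (`HomogeneousCircuits.lean`).

**Tavenas 2015, Thm. 1** (after Agrawal–Vinay 2008, Koiran 2012): a HOMOGENEOUS polynomial of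
degree `d` in `n` variables computed by an arithmetic circuit of size `s` is computed by a
homogeneous `ΣΠ^{[O(√d)]}ΣΠ^{[√d]}` circuit of size `2^{O(√d · log(ds))}` (`n ≤ s`). For a `VP`
family of homogeneous polynomials (`s, d ≤ poly(n)`), `√d log(ds) = O(√d log n)`, i.e. size
`(n+2)^{O(√d)}` — the same bookkeeping as in `DepthReduction.lean`. The fan-in bounds of the
printed conclusion are dropped (weaker than print); homogeneity of the circuit is kept. Nothing
asserted.

## References

* S. Tavenas, *Improved bounds for reduction to depth 4 and depth 3*, Inform. and Comput. 240
  (2015) 2–11, Thm. 1.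
* M. Agrawal, V. Vinay, *Arithmetic circuits: a chasm at depth four*, FOCS 2008, Thm. 3.2.
-/

noncomputable section

namespace Literature.Computability.AlgebraicComplexity

/-- NAMED FACT (**Tavenas 2015, Thm. 1, homogeneous `ΣΠΣΠ` form**): for every `VP` family
`f = (fₙ)` over `ℂ` of HOMOGENEOUS polynomials there is `c` such that every `fₙ` has a homogeneous
unbounded-fan-in circuit of product-depth `≤ 2` with at most `(n + 2)^{c⌊√(deg fₙ)⌋ + c}` gates:
`homProductDepthCircuitSize 2 (f n) ≤ (n + 2) ^ (c * Nat.sqrt (f n).totalDegree + c)`. Users take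
`(h : homProductDepthCircuitSize_two_le_of_isVPFamily)`.
[Tavenas 2015, Thm. 1; Agrawal–Vinay 2008, Thm. 3.2] [cite: Tavenas2015, Thm. 1] -/
def homProductDepthCircuitSize_two_le_of_isVPFamily : Prop :=
  ∀ {σ : ℕ → Type} [∀ n, Fintype (σ n)] (f : ∀ n, MvPolynomial (σ n) ℂ),
    IsVPFamily f → (∀ n, (f n).IsHomogeneous (f n).totalDegree) → ∃ c : ℕ, ∀ n : ℕ,
      homProductDepthCircuitSize 2 (f n) ≤ ((n + 2 : ℕ∞) ^ (c * Nat.sqrt ((f n).totalDegree) + c))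

/-- The homogeneous form implies the tree's non-homogeneous form for homogeneous `VP` families
(`productDepthCircuitSize ≤ homProductDepthCircuitSize`). [folklore] -/
theorem productDepthCircuitSize_two_le_of_hom (h : homProductDepthCircuitSize_two_le_of_isVPFamily)
    {σ : ℕ → Type} [∀ n, Fintype (σ n)] (f : ∀ n, MvPolynomial (σ n) ℂ) (hf : IsVPFamily f)
    (hhom : ∀ n, (f n).IsHomogeneous (f n).totalDegree) :
    ∃ c : ℕ, ∀ n : ℕ,
      productDepthCircuitSize 2 (f n) ≤ ((n + 2 : ℕ∞) ^ (c * Nat.sqrt ((f n).totalDegree) + c)) := by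
  obtain ⟨c, hc⟩ := h f hf hhom
  exact ⟨c, fun n => (productDepthCircuitSize_le_homProductDepthCircuitSize 2 (f n)).trans (hc n)⟩

end Literature.Computability.AlgebraicComplexity
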